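import Summits.CriticalPhenomena.CardyFormulaZ2.Theorems.CardyComplexConeSLESixFamiliesGiveCardyCollarDomainsPart3

/-!
# Window collar domains and the collar set-up (helper file 4 for `stub_collarDomains`)

Route `CardyComplexCone`, crux `SLESixFamiliesGiveCardy`, line `collar-touch-sandwich`, STUB E.

* Geometry of the profile collar domain `profileDomain T (W.profile hh hh1)` of a window profile
  relative to `Ω`: loop points over the open windows are off `closure Ω`, loop points in `closure Ω`
  are boundary points with profile value `1`, and every point of the closed collar domain off `Ω`
  (in the open collar domain or off `closure Ω`) lies in one of the two compact collar pieces over the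
  windows (`mem_collarPiece_union`).
* `CollarSetup R ε`: the numerical set-up of STUB E for a conformal rectangle `R` and a tolerance `ε`
  (tube data, a corner margin `δ`, a width `h`, with the tube within `min ε (depth of the centre)` of the
  boundary at levels `|s - 1| ≤ h`), and its existence `exists_collarSetup`.
* The UPPER comparison rectangle: windows `[m₁ + δ, m₂ - δ]`, `[m₃ + δ, m₀ + 1 - δ]` (collars behind
  shortened `(bc)` and `(da)`), mark parameters `(t_a - 1, t_b, m₂ - δ, m₃ + δ)` for collar marks
  `t_a ∈ [m₀ + 1 - 3δ, m₀ + 1 - 2δ]`, `t_b ∈ [m₁ + 2δ, m₁ + 3δ]` (on the plateaus), `upperRect`.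
-/

noncomputable section

open Set Metric Topology Filter
open Literature.Probability.RandomPlanarGeometry

namespace Summit.CriticalPhenomena.CardyFormulaZ2.Cruxes.SLESixFamiliesGiveCardy.CollarTouchSandwich

/-! ### Window collar domains relative to `Ω` -/

section WindowGeometry

variable (R : ConformalRectangle) (T : R.toJordanDomain.TubeData) (W : Windows) {h : ℝ} (hh : 0 < h) (hh1 : h ≤ 1 / 2)

/-- Where the profile is `1` the loop is the boundary of `Ω`. -/
theorem profileLoop_eq_boundary {t : ℝ} (ht : (W.profile hh hh1).p t = 1) :
    profileLoop T (W.profile hh hh1).p t = R.boundary t := by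
  rw [profileLoop, ht, T.tube_one]

/-- Where the profile is `1` on an interval, the loop and the boundary have the same image. -/
theorem image_profileLoop_eq {u v : ℝ} (huv : ∀ t ∈ Icc u v, (W.profile hh hh1).p t = 1) :
    profileLoop T (W.profile hh hh1).p '' Icc u v = R.boundary '' Icc u v :=
  image_congr fun t ht => profileLoop_eq_boundary R T W hh hh1 (huv t ht)

/-- **Loop points over the open windows are off `closure Ω`.** -/
theorem profileLoop_not_mem_closure {t : ℝ} (ht : W.rep t ∈ Ioo W.a₁ W.b₁ ∨ W.rep t ∈ Ioo W.a₂ W.b₂) :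
    profileLoop T (W.profile hh hh1).p t ∉ closure R.carrier :=
  T.tube_not_mem_closure ((W.one_lt_profile_iff hh hh1 t).2 ht) ((W.profile hh hh1).lt_two t) t

/-- **Loop points in `closure Ω` have profile value `1`** (their representative is off the windows). -/
theorem profile_eq_one_of_mem_closure {t : ℝ} (ht : profileLoop T (W.profile hh hh1).p t ∈ closure R.carrier) :
    W.rep t ∉ Ioo W.a₁ W.b₁ ∧ W.rep t ∉ Ioo W.a₂ W.b₂ := by
  by_contra hno
  rw [not_and_or, not_not, not_not] at hno
  exact profileLoop_not_mem_closure R T W hh hh1 hno ht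

/-- **Points of the closed collar domain off `Ω` are collar-piece points.** A point of
`closure (collar domain)` not in `Ω`, which is either in the open collar domain or off `closure Ω`, is a
tube point `tube s t` with `1 ≤ s ≤ 1 + h` and representative in an open window. -/
theorem exists_tube_of_mem {z : ℂ} (hz : z ∈ closure (profileDomain T (W.profile hh hh1)).carrier)
    (hzΩ : z ∉ R.carrier) (hor : z ∈ (profileDomain T (W.profile hh hh1)).carrier ∨ z ∉ closure R.carrier) :
    ∃ s t, s ∈ Icc 1 (1 + h) ∧ (W.rep t ∈ Ioo W.a₁ W.b₁ ∨ W.rep t ∈ Ioo W.a₂ W.b₂) ∧ z = T.tube s t := by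
  set P := W.profile hh hh1 with hP
  by_cases hcl : z ∈ closure R.carrier
  · -- a frontier point of `Ω` inside the open collar domain: `z = ∂Ω(t) = tube 1 t` with `p t > 1`
    have hzin : z ∈ (profileDomain T P).carrier := hor.resolve_right (not_not.2 hcl)
    have hfr : z ∈ frontier R.carrier := by
      rw [frontier_eq_closure_inter_closure]; exact ⟨hcl, subset_closure hzΩ⟩
    rw [← R.range_boundary] at hfr
    obtain ⟨t, rfl⟩ := hfr
    have hne : P.p t ≠ 1 := fun h1 =>
      Set.disjoint_left.1 (profileDomain T P).disjoint_carrier_frontier hzin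
        ((boundary_mem_frontier_profileDomain_iff T P t).2 h1)
    have hgt : 1 < P.p t := lt_of_le_of_ne (W.one_le_profile hh hh1 t) (Ne.symm hne)
    exact ⟨1, t, ⟨le_rfl, by linarith⟩, (W.one_lt_profile_iff hh hh1 t).1 hgt, (T.tube_one t).symm⟩
  · obtain ⟨s, t, hs1, hsp, -, rfl, -⟩ := exists_eq_tube_of_mem_closure T P hz hcl
    have hgt : 1 < P.p t := hs1.trans_le hsp
    exact ⟨s, t, ⟨hs1.le, hsp.trans (P.upper t)⟩, (W.one_lt_profile_iff hh hh1 t).1 hgt, rfl⟩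

/-- The same, as membership in the union of the two collar pieces. -/
theorem mem_collarPiece_union {z : ℂ} (hz : z ∈ closure (profileDomain T (W.profile hh hh1)).carrier)
    (hzΩ : z ∉ R.carrier) (hor : z ∈ (profileDomain T (W.profile hh hh1)).carrier ∨ z ∉ closure R.carrier) :
    z ∈ collarPiece R T h W.a₁ W.b₁ ∪ collarPiece R T h W.a₂ W.b₂ := by
  obtain ⟨s, t, hs, ht, rfl⟩ := exists_tube_of_mem R T W hh hh1 hz hzΩ hor
  have hrep := W.rep_eq t
  rcases ht with ht | ht
  · exact Or.inl (tube_mem_collarPiece R T hs (n := -⌊t - W.m⌋) (by rw [← hrep]; exact Ioo_subset_Icc_self ht))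
  · exact Or.inr (tube_mem_collarPiece R T hs (n := -⌊t - W.m⌋) (by rw [← hrep]; exact Ioo_subset_Icc_self ht))

end WindowGeometry

/-! ### The collar set-up -/

/-- **The numerical set-up of STUB E** for a conformal rectangle `R` and a tolerance `ε > 0`: tube data,
a corner margin `δ > 0` with `3δ ≤ ε` and `5δ` below every parameter gap between consecutive marks, a
width `0 < h ≤ 1/4`, and the tube within `min ε (depth of the centre)` of `∂Ω` at levels `|s - 1| ≤ h`. -/
structure CollarSetup (R : ConformalRectangle) (ε : ℝ) where
  /-- Tube data. -/
  T : R.toJordanDomain.TubeData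
  /-- The corner margin. -/
  δ : ℝ
  /-- The collar width. -/
  h : ℝ
  /-- The tolerance is positive. -/
  ε_pos : 0 < ε
  /-- The margin is positive. -/
  δ_pos : 0 < δ
  /-- `3δ ≤ ε`. -/
  δ_le : 3 * δ ≤ ε
  /-- `5δ < m₁ - m₀`. -/
  gap₀ : 5 * δ < R.mark 1 - R.mark 0
  /-- `5δ < m₂ - m₁`. -/
  gap₁ : 5 * δ < R.mark 2 - R.mark 1
  /-- `5δ < m₃ - m₂`. -/
  gap₂ : 5 * δ < R.mark 3 - R.mark 2
  /-- `5δ < m₀ + 1 - m₃`. -/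
  gap₃ : 5 * δ < R.mark 0 + 1 - R.mark 3
  /-- The width is positive. -/
  h_pos : 0 < h
  /-- The width is at most `1/4`. -/
  h_le : h ≤ 1 / 4
  /-- The tube is uniformly close to the boundary at levels `|s - 1| ≤ h`. -/
  dist_lt : ∀ s t, 1 - h ≤ s → s ≤ 1 + h →
    dist (T.tube s t) (R.boundary t) < min ε (infDist T.z₀ (frontier R.carrier))

/-- **Collar set-ups exist** for every tolerance. -/
theorem exists_collarSetup (R : ConformalRectangle) {ε : ℝ} (hε : 0 < ε) : Nonempty (CollarSetup R ε) := by
  obtain ⟨T⟩ := R.toJordanDomain.nonempty_tubeData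
  obtain ⟨h0, h1, h2, h3, h4⟩ := R.marks_chain
  have hd := R.toJordanDomain.infDist_frontier_pos T.hz₀
  obtain ⟨h₀, hh₀, -, hdist⟩ := T.exists_dist_tube_lt (ε := min ε (infDist T.z₀ (frontier R.carrier))) (lt_min hε hd)
  set g : ℝ := min (min (R.mark 1 - R.mark 0) (R.mark 2 - R.mark 1)) (min (R.mark 3 - R.mark 2) (R.mark 0 + 1 - R.mark 3))
  have hg : 0 < g := lt_min (lt_min (by linarith) (by linarith)) (lt_min (by linarith) (by linarith))
  have hg0 : g ≤ R.mark 1 - R.mark 0 := (min_le_left _ _).trans (min_le_left _ _)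
  have hg1 : g ≤ R.mark 2 - R.mark 1 := (min_le_left _ _).trans (min_le_right _ _)
  have hg2 : g ≤ R.mark 3 - R.mark 2 := (min_le_right _ _).trans (min_le_left _ _)
  have hg3 : g ≤ R.mark 0 + 1 - R.mark 3 := (min_le_right _ _).trans (min_le_right _ _)
  set δ : ℝ := min (ε / 3) (g / 6)
  have hδε : δ ≤ ε / 3 := min_le_left _ _
  have hδg : δ ≤ g / 6 := min_le_right _ _
  refine ⟨⟨T, δ, min h₀ (1 / 4), hε, lt_min (by linarith) (by linarith), by linarith, by linarith, by linarith,
    by linarith, by linarith, lt_min hh₀ (by norm_num), min_le_right _ _, fun s t hs hs' => hdist s t ?_ ?_⟩⟩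
  · linarith [min_le_left h₀ (1 / 4)]
  · linarith [min_le_left h₀ (1 / 4)]

namespace CollarSetup

variable {R : ConformalRectangle} {ε : ℝ} (S : CollarSetup R ε)

/-- The width is at most `1/2`. -/
theorem h_le_half : S.h ≤ 1 / 2 := S.h_le.trans (by norm_num)

/-- The tube is within `ε` of the boundary at levels `|s - 1| ≤ h`. -/
theorem dist_lt_ε {s : ℝ} (t : ℝ) (hs : 1 - S.h ≤ s) (hs' : s ≤ 1 + S.h) : dist (S.T.tube s t) (R.boundary t) < ε :=
  (S.dist_lt s t hs hs').trans_le (min_le_left _ _)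

/-- The loop of any profile of width `h` is closer to `∂Ω` than the depth of the centre. -/
theorem hclose (P : Profile) (hP : P.h = S.h) (t : ℝ) :
    dist (profileLoop S.T P.p t) (R.boundary t) < infDist S.T.z₀ (frontier R.carrier) := by
  have h1 := P.lower t; have h2 := P.upper t
  rw [hP] at h1 h2
  exact (S.dist_lt _ t h1 h2).trans_le (min_le_right _ _)

/-! ### The upper comparison rectangle -/

/-- The windows of the upper rectangle: `[m₁ + δ, m₂ - δ]` and `[m₃ + δ, m₀ + 1 - δ]`, ramp `δ`. -/
def upperW : Windows where
  m := R.mark 0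
  a₁ := R.mark 1 + S.δ
  b₁ := R.mark 2 - S.δ
  a₂ := R.mark 3 + S.δ
  b₂ := R.mark 0 + 1 - S.δ
  d := S.δ
  m_lt := by linarith [R.marks_chain.2.1, S.δ_pos]
  a₁_lt := by linarith [S.gap₁, S.δ_pos]
  b₁_lt := by linarith [R.marks_chain.2.2.2.1, S.δ_pos]
  a₂_lt := by linarith [S.gap₃, S.δ_pos]
  b₂_lt := by linarith [S.δ_pos]
  d_pos := S.δ_pos

/-- The profile of the upper rectangle. -/
def upperP : Profile := S.upperW.profile S.h_pos S.h_le_half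

/-- The collar domain of the upper rectangle. -/
def upperDomain : JordanDomain := profileDomain S.T S.upperP

/-- The mark parameters of the upper rectangle for collar marks `t_a`, `t_b` on the plateaus. -/
def upperM {t_a t_b : ℝ} (hta : t_a ∈ Icc (R.mark 0 + 1 - 3 * S.δ) (R.mark 0 + 1 - 2 * S.δ))
    (htb : t_b ∈ Icc (R.mark 1 + 2 * S.δ) (R.mark 1 + 3 * S.δ)) : MarkParams where
  τ := ![t_a - 1, t_b, R.mark 2 - S.δ, R.mark 3 + S.δ]
  lt₀₁ := by have := R.marks_chain; have := S.δ_pos; simp; linarith [hta.2, htb.1]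
  lt₁₂ := by have := S.gap₁; have := S.δ_pos; simp; linarith [htb.2]
  lt₂₃ := by have := R.marks_chain; have := S.δ_pos; simp; linarith
  lt₃₀ := by have := S.gap₃; have := S.δ_pos; simp; linarith [hta.1]

/-- **The upper comparison rectangle** `(Ω₁; a⁺, b⁺, c′, d′)`. -/
def upperRect {t_a t_b : ℝ} (hta : t_a ∈ Icc (R.mark 0 + 1 - 3 * S.δ) (R.mark 0 + 1 - 2 * S.δ))
    (htb : t_b ∈ Icc (R.mark 1 + 2 * S.δ) (R.mark 1 + 3 * S.δ)) : ConformalRectangle :=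
  rebase S.upperDomain (S.upperM hta htb)

variable {t_a t_b : ℝ} (hta : t_a ∈ Icc (R.mark 0 + 1 - 3 * S.δ) (R.mark 0 + 1 - 2 * S.δ))
  (htb : t_b ∈ Icc (R.mark 1 + 2 * S.δ) (R.mark 1 + 3 * S.δ))

/-- The mark parameters of the upper rectangle, unfolded. -/
theorem upperM_τ : (S.upperM hta htb).τ 0 = t_a - 1 ∧ (S.upperM hta htb).τ 1 = t_b ∧
    (S.upperM hta htb).τ 2 = R.mark 2 - S.δ ∧ (S.upperM hta htb).τ 3 = R.mark 3 + S.δ := ⟨rfl, rfl, rfl, rfl⟩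

/-- The carrier of the upper rectangle is the upper collar domain. -/
@[simp] theorem carrier_upperRect : (S.upperRect hta htb).carrier = S.upperDomain.carrier := rfl

/-- The boundary loop of the upper rectangle is the re-based profile loop. -/
theorem boundary_upperRect (s : ℝ) :
    (S.upperRect hta htb).boundary s = profileLoop S.T S.upperP.p (s + (t_a - 1)) := rfl

/-- The marks of the upper rectangle shifted back by `c = t_a - 1`. -/
theorem mark_upperRect_add (i : Fin 4) : (S.upperRect hta htb).mark i + (t_a - 1) = (S.upperM hta htb).τ i := by
  rw [upperRect, mark_rebase_eq]; show _ - (t_a - 1) + (t_a - 1) = _; ring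

/-- **The arcs of the upper readout**: wired arc `L[t_a - 1, t_b]`, dual arc `L[t_b, t_a]`, touch set
`Q.arc 2 = L[m₂ - δ, m₃ + δ]`, marks `L (t_a - 1)`, `L t_b`. -/
theorem upper_arcs :
    ((S.upperRect hta htb).chord 0 1 (by decide)).arc 0 = profileLoop S.T S.upperP.p '' Icc (t_a - 1) t_b ∧
    ((S.upperRect hta htb).chord 0 1 (by decide)).arc 1 = profileLoop S.T S.upperP.p '' Icc t_b t_a ∧
    (S.upperRect hta htb).arc 2 = profileLoop S.T S.upperP.p '' Icc (R.mark 2 - S.δ) (R.mark 3 + S.δ) ∧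
    ((S.upperRect hta htb).chord 0 1 (by decide)).pt 0 = profileLoop S.T S.upperP.p (t_a - 1) ∧
    ((S.upperRect hta htb).chord 0 1 (by decide)).pt 1 = profileLoop S.T S.upperP.p t_b := by
  obtain ⟨h0, h1⟩ := arc_chord01 S.upperDomain (S.upperM hta htb)
  obtain ⟨-, h2⟩ := arc_rebase S.upperDomain (S.upperM hta htb)
  refine ⟨h0, ?_, h2, ?_, ?_⟩
  · rw [upperRect, h1]; show _ '' Icc t_b (t_a - 1 + 1) = _; rw [sub_add_cancel]; rfl
  · rw [MarkedDomain.pt_chord_zero, upperRect, pt_rebase]; rfl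
  · rw [MarkedDomain.pt_chord_one, upperRect, pt_rebase]; rfl

end CollarSetup

/-- **Main statement of this file** (registered helper stub, arrow style): collar set-ups exist. -/
theorem collarSetup_nonempty : ∀ (R : ConformalRectangle) {ε : ℝ}, 0 < ε → Nonempty (CollarSetup R ε) :=
  fun R _ hε => exists_collarSetup R hε

end Summit.CriticalPhenomena.CardyFormulaZ2.Cruxes.SLESixFamiliesGiveCardy.CollarTouchSandwich

end
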